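/-
Copyright (c) 2026 The h413 squad. All rights reserved.
Released under Apache 2.0 license as described in the file LICENSE.
Authors: K2E3-p14 (g3), (SC-an) line lead
-/
import Summits.HodgeConjecture.HodgeConjecture.Theorems.K2E3TruncatedCharTorusSlicing        -- ★ (M5b) p856875 (K2E5-p01): `integral_heightBall_norm_conj_le` (the `A`-volume slicing)
import Summits.HodgeConjecture.HodgeConjecture.Theorems.K2E3SplitTorusOrbitalBoundRankOne    -- ★ (M5a) p856869 (K2E3-p20): `exists_const_lintegral_descConj_torusU_le` (Theorem 14, split torus)
import Summits.HodgeConjecture.HodgeConjecture.Theorems.K2E3SplitTorusTwistModuleBound       -- ★ p856900 (K2E3-p20): `twistModule_le_pow_mul_inv_sqrt_prod` (`J(t) ≤ q^m (√∏)⁻¹`), `twistModule_le_pow`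
import Summits.HodgeConjecture.HodgeConjecture.Theorems.K2E3SplitTorusDepthFromDiscriminant  -- ★ p856891 (this seat): `charpoly_discr_coe_glDiagonal`, `det_coe_glDiagonal`
import HarnessLib

/-!
# K2_E3 road (h413), socket #11 (SC-an), END-GAME MAP v3 piece (M5e-1): THE SPLIT-REGULAR BALL BOUND FOR A TRUNCATED COEFFICIENT ON `U(σ, Φ₃)(K)` — ASSEMBLY

Harish-Chandra, *Harmonic analysis on reductive p-adic groups* (1970), Part VII §3 pp. 71–72 (the estimate `|Θ_T(γ^y)| ≤ c (1+|λ(γ)|)^r |D(γ)|^{-1∕2}`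
behind Theorem 19∕20) at rank one, on the MODEL group `U = U(σ, Φ₃)(K)` with its diagonal split torus `T = torusU σ Φ₃`.  This file only ASSEMBLES landed bricks:

* ★ (D2a) `exists_conjugator_mem_heightBall` (K2E3-p21): a split-regular `g = y t y⁻¹ ∈ Ω_m` of depth `λ` has a conjugator `y₀ ∈ Ω_{2m+2λ}`;
* ★ (M5b) `integral_heightBall_norm_conj_le` (K2E5-p01): `∫_{Ω R} ‖θ(x g x⁻¹)‖ dμ ≤ ((2(R+s+2m_θ+2λ)+1) · ρ(T ∩ Ω₀) · ∫_{U⧸T} ‖θ(ẋ t ẋ⁻¹)‖ dμQ) ∕ c`;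
* ★ (M5a) `exists_const_lintegral_descConj_torusU_le` (K2E3-p20): `∫_{U⧸T} Θ(ẋ t ẋ⁻¹) dμQ ≤ C · M · J(t)` uniformly in the regular `t ∈ T` (Theorem 14, split torus);
* ★ `twistModule_le_pow_mul_inv_sqrt_prod` (K2E3-p20): `J(t) ≤ q^m · (√∏_{i<j}|d_i − d_j|)⁻¹` on `Ω_m`, and ★ (M5e-2) (this seat): `discr χ_{diag d} = ∏(d_i−d_j)²`, `det = d₀d₁d₂`.

Results (all on the model, in the squad's frozen currency — `Ω` the height exhaustion with `hmem`∕`hinv`∕`hmul`, depth `hreg`, (M5a)'s binders `hunimod`∕`hK₁`∕`hKB` kept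
as hypotheses to be discharged at `K = L_w` by (M5a) §5):

* §1 `hasCompactSupport_of_support_subset`, `isUnit_ratio_sub_one_of_depth` — bookkeeping (`θ` supported in `Ω_{m_θ}` has compact support; depth `λ` ⇒ `t` regular);
* §2 `exists_const_integral_heightBall_norm_conj_le` — ONE constant `C` (depending on `m_θ` and the measures only) with, for every continuous `θ` supported in `Ω_{m_θ}` and
  bounded by `M`, every split-regular `g = y t y⁻¹ ∈ Ω_m` (`t = diag d` of depth `λ`) and every radius `R`:
  `∫_{Ω R} ‖θ(x g x⁻¹)‖ dμ ≤ C · M · (2(R + 2m + 2m_θ + 4λ) + 1) · J(t)` (verbatim twist-module token of ★ (M5a));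
* §3 `exists_const_integral_heightBall_norm_conj_le_sqrt_prod` — the same with `J(t)` replaced by `q^m · (√∏_{i<j}|d_i − d_j|)⁻¹` (no regularity binders left: depth `λ`
  implies `t` regular, `g ∈ Ω_m` implies `|ϖ^m d₀| ≤ 1`);
* §4 `sqrt_sqrt_token_eq_sqrt_prod`, `exists_const_integral_heightBall_norm_conj_le_token` — the same in the line's frozen token `T(g) = √√(|discr χ_g| · |det g|⁻²)`
  computed from `g` itself (`charpoly`∕`det` are conjugation invariant): `∫_{Ω R} ‖θ(x g x⁻¹)‖ dμ ≤ C · M · (2(R + 2m + 2m_θ + 4λ) + 1) · q^m · T(g)⁻¹`.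

This is the `hball` brick of ★ p856355 ∕ ★ [M6] `sigSCan_datum_of_domination_bricks` on the split-regular locus, before transport to `(cmDatum L 3 H).Local v` ((M5h)).
HC_CM is proved only modulo the printed citations; this file is a count-neutral helper.
-/

set_option autoImplicit false
set_option linter.dupNamespace false

noncomputable section

open MeasureTheory Measure Set Filter Topology
open scoped NNReal ENNReal Pointwise Matrix MatrixGroups WithZero
open Literature.NumberTheory.Automorphic Literature.NumberTheory.Automorphic.UnitaryGroup
open Literature.NumberTheory.GaloisRepresentations Literature.NumberTheory.GaloisRepresentations.IsNonarchimedeanLocalField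
open Literature.MeasureTheory.Group
open Summit.HodgeConjecture.HodgeConjecture.Cruxes.H413.K2E3CuspFormCancellationU3Torus
open Summit.HodgeConjecture.HodgeConjecture.Cruxes.H413.K2E3ConjugatorHeightControlRankOne
open Summit.HodgeConjecture.HodgeConjecture.Cruxes.H413.K2E3TruncatedCharTorusSlicing
open Summit.HodgeConjecture.HodgeConjecture.Cruxes.H413.K2E3SplitTorusOrbitalBoundRankOne
open Summit.HodgeConjecture.HodgeConjecture.Cruxes.H413.K2E3SplitTorusTwistModuleBound
open Summit.HodgeConjecture.HodgeConjecture.Cruxes.H413.K2E3SplitTorusDepthFromDiscriminant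

namespace Summit.HodgeConjecture.HodgeConjecture.Cruxes.H413.K2E3SupercuspBallBoundSplitAssembly

/-! ## §1 Bookkeeping: compact support from the height ball; regularity from the depth -/

section Bookkeeping

variable {K : Type*} [Field K] [Valued K ℤᵐ⁰] (σ : K →+* K) {J : Matrix (Fin 3) (Fin 3) K}

/-- A function supported in one ball `Ω_{m_θ}` of a compact exhaustion has compact support. [cite: HarishChandra1970, Part VII §3 p. 71] -/
theorem hasCompactSupport_of_support_subset {E : Type*} [Zero E] (Ω : CompactExhaustion ↥(unitaryGroupOfForm σ J))
    {θ : ↥(unitaryGroupOfForm σ J) → E} {mθ : ℕ} (hθ : ∀ g, θ g ≠ 0 → g ∈ Ω mθ) : HasCompactSupport θ :=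
  HasCompactSupport.intro (Ω.isCompact mθ) fun g hg => not_not.1 fun h => hg (hθ g h)

variable {ϖ : K} (hϖ : Valued.v ϖ = WithZero.exp (-1 : ℤ))

include hϖ in
/-- Depth `λ` (`|ϖ^λ| ≤ |d_i − d_k|` for `i ≠ k`) implies that the root values `d₀⁻¹d₁ − 1`, `d₀⁻¹d₂ − 1` of `t = diag d` are units, i.e. `t` is regular
(the binders `ha`, `hb` of ★ (M5a)). [cite: HarishChandra1970, Part VII §2 p. 69] -/
theorem isUnit_ratio_sub_one_of_depth {d : Fin 3 → Kˣ} {lam : ℕ} (hreg : ∀ i k : Fin 3, i ≠ k → Valued.v (ϖ ^ lam) ≤ Valued.v ((d i : K) - d k))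
    {k : Fin 3} (hk : k ≠ 0) : IsUnit ((((d 0)⁻¹ * d k : Kˣ) : K) - 1) := by
  rw [isUnit_iff_ne_zero]
  intro h0
  have hϖ0 : Valued.v (ϖ ^ lam) ≠ 0 := by
    rw [map_pow, hϖ]; exact pow_ne_zero _ WithZero.coe_ne_zero
  have hsub : (d 0 : K) - d k = -(d 0 : K) * ((((d 0)⁻¹ * d k : Kˣ) : K) - 1) := by
    rw [Units.val_mul, Units.val_inv_eq_inv_val]; field_simp; ring
  have := hreg 0 k (Ne.symm hk)
  rw [hsub, h0, mul_zero, map_zero, le_zero_iff] at this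
  exact hϖ0 this

end Bookkeeping

/-! ## §2 The assembled ball bound in the twist-module currency -/

section Assembly

variable {K : Type*} [Field K] [Valued K ℤᵐ⁰] [ValuativeRel K] [(Valued.v : Valuation K ℤᵐ⁰).Compatible] [IsNonarchimedeanLocalField K]
  [T2Space K] [SecondCountableTopology K] [MeasurableSpace K] [BorelSpace K]
  (σ : K →+* K) (hσ : ∀ x, σ (σ x) = x) (hσc : Continuous σ) (hσv : ∀ x, Valued.v (σ x) = Valued.v x) (hσ1 : ∃ x : K, σ x ≠ x) (h2 : (2 : K) ≠ 0)
  {J : Matrix (Fin 3) (Fin 3) K} (hJ : J = (StdForm.antidiagonal 3).over K) {ϖ : K} (hϖ : Valued.v ϖ = WithZero.exp (-1 : ℤ))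
  [MeasurableSpace ↥(unitaryGroupOfForm σ J)] [BorelSpace ↥(unitaryGroupOfForm σ J)]
  [SecondCountableTopology ↥(unitaryGroupOfForm σ J)] [LocallyCompactSpace ↥(unitaryGroupOfForm σ J)]
  (μ : Measure ↥(unitaryGroupOfForm σ J)) [μ.IsHaarMeasure] [μ.IsMulRightInvariant]
  (ρ : Measure ↥(torusU σ J)) [ρ.IsMulLeftInvariant] [SFinite ρ] [IsFiniteMeasureOnCompacts ρ]
  [MeasurableSpace (↥(unitaryGroupOfForm σ J) ⧸ torusU σ J)] [BorelSpace (↥(unitaryGroupOfForm σ J) ⧸ torusU σ J)]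
  (μQ : Measure (↥(unitaryGroupOfForm σ J) ⧸ torusU σ J))
  [SMulInvariantMeasure ↥(unitaryGroupOfForm σ J) (↥(unitaryGroupOfForm σ J) ⧸ torusU σ J) μQ] [IsFiniteMeasureOnCompacts μQ]
  (Ω : CompactExhaustion ↥(unitaryGroupOfForm σ J))
  (hmem : ∀ (m : ℕ) (g : ↥(unitaryGroupOfForm σ J)), g ∈ Ω m ↔
    (∀ i j, Valued.v (ϖ ^ m * ((g : GL (Fin 3) K) : Matrix (Fin 3) (Fin 3) K) i j) ≤ 1) ∧
      ∀ i j, Valued.v (ϖ ^ m * (((g : GL (Fin 3) K)⁻¹ : GL (Fin 3) K) : Matrix (Fin 3) (Fin 3) K) i j) ≤ 1)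
  (hinv : ∀ (m : ℕ) (g : ↥(unitaryGroupOfForm σ J)), g ∈ Ω m → g⁻¹ ∈ Ω m)
  (hmul : ∀ (a b : ℕ) (g h : ↥(unitaryGroupOfForm σ J)), g ∈ Ω a → h ∈ Ω b → g * h ∈ Ω (a + b))

omit [(Valued.v : Valuation K ℤᵐ⁰).Compatible] in
include hσ h2 hσv hJ hϖ hmem hinv hmul in
/-- **(M5e-1) THE SPLIT-REGULAR BALL BOUND, TWIST-MODULE CURRENCY.**  On `U = U(σ, Φ₃)(K)` with `T` the diagonal torus, `μ` a (left and right invariant) Haar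
measure, `ρ ≠ 0` left invariant on `T`, `μQ ≠ 0` any `U`-invariant measure on `U ⧸ T` finite on compacta, and (M5a)'s frame (`hunimod`, `U = K₁ · B` with `K₁`
compact): for every `m_θ` there is ONE `C : ℝ≥0` such that for every continuous `θ : U → E` supported in `Ω_{m_θ}` with `‖θ‖ ≤ M`, every `t = diag d ∈ T` (root
values `a − 1`, `b − 1` units) of depth `λ`, every `g = y t y⁻¹ ∈ Ω_m` and every radius `R`:
`∫_{Ω R} ‖θ(x g x⁻¹)‖ dμ ≤ C · M · (2 (R + 2m + 2m_θ + 4λ) + 1) · J(t)`, `J(t) = (‖a−1‖_K · χ⁻(b−1))⁻¹` the module of ★ (M5a).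
Proof: ★ (D2a) gives `y₀ ∈ Ω_{2m+2λ}` with `g = y₀ t y₀⁻¹`; ★ (M5b) slices with `s = 2m + 2λ`; ★ (M5a) bounds the quotient integral; `C = ρ(T ∩ Ω₀) · C_{14} ∕ c`.
[cite: HarishChandra1970, Part VII §3 pp. 71–72; Part VI §8 Theorem 14 p. 60] [cite: Rogawski1990, §7.3 p. 97] -/
theorem exists_const_integral_heightBall_norm_conj_le
    (hunimod : ∀ ν : Measure ↥(unitaryGroupOfForm σ J), ν.IsHaarMeasure → ν.IsMulRightInvariant)
    {K₁ : Subgroup ↥(unitaryGroupOfForm σ J)} (hK₁ : IsCompact (K₁ : Set ↥(unitaryGroupOfForm σ J)))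
    (hKB : ∀ g : ↥(unitaryGroupOfForm σ J), ∃ k ∈ K₁, ∃ b ∈ borelU σ J, g = k * b)
    (hμQ : μQ ≠ 0) (hρ : ρ ≠ 0) (mθ : ℕ) {E : Type*} [NormedAddCommGroup E] :
    ∃ C : ℝ≥0, ∀ (θ : ↥(unitaryGroupOfForm σ J) → E), Continuous θ → (∀ g, θ g ≠ 0 → g ∈ Ω mθ) → ∀ (M : ℝ≥0), (∀ g, ‖θ g‖₊ ≤ M) →
      ∀ (t : ↥(torusU σ J)) (d : Fin 3 → Kˣ) (hd : glDiagonal 3 K d = ((t : ↥(unitaryGroupOfForm σ J)) : GL (Fin 3) K))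
        (ha : IsUnit ((((d 0)⁻¹ * d 1 : Kˣ) : K) - 1)) (hb : IsUnit ((((d 0)⁻¹ * d 2 : Kˣ) : K) - 1))
        (lam : ℕ), (∀ i k : Fin 3, i ≠ k → Valued.v (ϖ ^ lam) ≤ Valued.v ((d i : K) - d k)) →
        ∀ (g y : ↥(unitaryGroupOfForm σ J)) (m : ℕ), g ∈ Ω m → g = y * (t : ↥(unitaryGroupOfForm σ J)) * y⁻¹ → ∀ (R : ℕ),
          ∫ x in Ω R, ‖θ (x * g * x⁻¹)‖ ∂μ ≤
            C * M * ((2 * (R + 2 * m + 2 * mθ + 4 * lam) + 1 : ℕ) : ℝ) *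
              (((distribHaarChar K ha.unit)⁻¹ *
                (HeisRing.skewModulus σ hσc hb.unit (HeisRing.map_unit_torusCentralScalar_sub_one σ hJ t hd hb))⁻¹ : ℝ≥0) : ℝ) := by
  haveI : IsClosed ((torusU σ J : Subgroup ↥(unitaryGroupOfForm σ J)) : Set ↥(unitaryGroupOfForm σ J)) := isClosed_torusU_of_t1Space σ J
  -- ★ (M5a): the Theorem-14 constant for the compact set `Ω m_θ`
  obtain ⟨C₁, hC₁⟩ := exists_const_lintegral_descConj_torusU_le σ hσ hσc h2 hJ hunimod hK₁ hKB μQ (Ω.isCompact mθ)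
  -- the finite torus volume `ρ(T ∩ Ω 0)` and the positive unfolding constant
  have hρ0fin := (measure_torusU_heightBall_zero_lt_top σ Ω ρ).ne
  set ρ0 : ℝ≥0 := (ρ {a : ↥(torusU σ J) | (a : ↥(unitaryGroupOfForm σ J)) ∈ Ω 0}).toNNReal with hρ0def
  have hρ0 : ρ {a : ↥(torusU σ J) | (a : ↥(unitaryGroupOfForm σ J)) ∈ Ω 0} = (ρ0 : ℝ≥0∞) := (ENNReal.coe_toNNReal hρ0fin).symm
  set c : ℝ≥0 := unfoldingConstant (torusU σ J) ρ μQ μ with hcdef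
  have hc0 : c ≠ 0 := (unfoldingConstant_pos (torusU σ J) ρ μQ μ hμQ hρ).ne'
  refine ⟨ρ0 * C₁ / c, fun θ hθc hθ M hM t d hd ha hb lam hreg g y m hg hgy R => ?_⟩
  -- ★ (D2a): a conjugator of height `2m + 2λ`
  obtain ⟨y₀, hy₀, hgy₀⟩ := exists_conjugator_mem_heightBall σ hσv hσ hJ hϖ (⇑Ω) hmem hd hreg hg hgy
  have ht : ∀ a ∈ torusU σ J, a * (t : ↥(unitaryGroupOfForm σ J)) = (t : ↥(unitaryGroupOfForm σ J)) * a := torusU_comm_of_glDiagonal σ hd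
  -- ★ (M5a) at `Θ = ‖θ‖ₑ`
  have hmeas : Measurable fun g : ↥(unitaryGroupOfForm σ J) => ‖θ g‖ₑ := (continuous_enorm.comp hθc).measurable
  have hsupp : ∀ g : ↥(unitaryGroupOfForm σ J), ‖θ g‖ₑ ≠ 0 → g ∈ Ω mθ := fun g hg => hθ g (enorm_ne_zero.1 hg)
  have hbdd : ∀ g : ↥(unitaryGroupOfForm σ J), ‖θ g‖ₑ ≤ (M : ℝ≥0∞) := fun g => by
    rw [enorm_eq_nnnorm]; exact ENNReal.coe_le_coe.2 (hM g)
  set tw : ℝ≥0 := ((distribHaarChar K ha.unit)⁻¹ *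
    (HeisRing.skewModulus σ hσc hb.unit (HeisRing.map_unit_torusCentralScalar_sub_one σ hJ t hd hb))⁻¹ : ℝ≥0) with htw
  have hI : ∫⁻ q, descConj (t : ↥(unitaryGroupOfForm σ J)) (torusU σ J) ht (fun g => ‖θ g‖ₑ) q ∂μQ ≤ (C₁ : ℝ≥0∞) * M * tw :=
    hC₁ _ hmeas hsupp _ hbdd t ht d hd ha hb
  have hfin : ∫⁻ q, descConj (t : ↥(unitaryGroupOfForm σ J)) (torusU σ J) ht (fun g => ‖θ g‖ₑ) q ∂μQ ≠ ∞ :=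
    ne_top_of_le_ne_top (by finiteness) hI
  -- ★ (M5b) with `s = 2m + 2λ`
  have hslice := integral_heightBall_norm_conj_le σ hσv hσ hJ hϖ μ ρ μQ Ω hmem hinv hmul hμQ hρ hθc hθ ht hd hreg hy₀ R hfin
  rw [← hgy₀] at hslice
  refine hslice.trans ?_
  -- compare the two right-hand sides
  have e : 2 * (R + (2 * m + 2 * lam) + 2 * mθ + 2 * lam) + 1 = 2 * (R + 2 * m + 2 * mθ + 4 * lam) + 1 := by ring
  rw [e, hρ0]
  set N : ℕ := 2 * (R + 2 * m + 2 * mθ + 4 * lam) + 1 with hN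
  have hle : ((N : ℝ≥0∞) * (ρ0 : ℝ≥0∞) * ∫⁻ q, descConj (t : ↥(unitaryGroupOfForm σ J)) (torusU σ J) ht (fun g => ‖θ g‖ₑ) q ∂μQ) / (c : ℝ≥0∞) ≤
      (((N : ℝ≥0) * ρ0 * (C₁ * M * tw) / c : ℝ≥0) : ℝ≥0∞) := by
    rw [ENNReal.coe_div hc0]
    refine ENNReal.div_le_div_right ?_ _
    push_cast
    exact mul_le_mul' le_rfl hI
  refine (ENNReal.toReal_mono ENNReal.coe_ne_top hle).trans_eq ?_
  rw [ENNReal.coe_toReal]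
  push_cast
  field_simp

include hσ hσc h2 hσv hσ1 hJ hϖ hmem hinv hmul in
/-- **(M5e-1′) THE SPLIT-REGULAR BALL BOUND, `|D|^{−1∕2}` CURRENCY.**  Same frame; the depth `λ` alone is assumed on `t = diag d` (it forces `t` regular), and `g ∈ Ω_m`
forces `|ϖ^m d₀| ≤ 1` (★ `mem_heightBall_torus_of_conj_mem`), so ★ `twistModule_le_pow_mul_inv_sqrt_prod` turns `J(t)` into `q^m · (√(|d₀−d₁| |d₀−d₂| |d₁−d₂|))⁻¹`:
`∫_{Ω R} ‖θ(x g x⁻¹)‖ dμ ≤ C · M · (2 (R + 2m + 2m_θ + 4λ) + 1) · q^m · (√∏_{i<j}|d_i − d_j|)⁻¹` — Harish-Chandra's `c (1+|λ(γ)|)^r |D(γ)|^{−1∕2}` with every exponent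
explicit and linear. [cite: HarishChandra1970, Part VII §3 pp. 71–72; Part VI §8 Theorem 14 p. 60] [cite: Rogawski1990, §4.9 (4.9.2) p. 55; §7.3 p. 97] -/
theorem exists_const_integral_heightBall_norm_conj_le_sqrt_prod
    (hunimod : ∀ ν : Measure ↥(unitaryGroupOfForm σ J), ν.IsHaarMeasure → ν.IsMulRightInvariant)
    {K₁ : Subgroup ↥(unitaryGroupOfForm σ J)} (hK₁ : IsCompact (K₁ : Set ↥(unitaryGroupOfForm σ J)))
    (hKB : ∀ g : ↥(unitaryGroupOfForm σ J), ∃ k ∈ K₁, ∃ b ∈ borelU σ J, g = k * b)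
    (hμQ : μQ ≠ 0) (hρ : ρ ≠ 0) (mθ : ℕ) {E : Type*} [NormedAddCommGroup E] :
    ∃ C : ℝ≥0, ∀ (θ : ↥(unitaryGroupOfForm σ J) → E), Continuous θ → (∀ g, θ g ≠ 0 → g ∈ Ω mθ) → ∀ (M : ℝ≥0), (∀ g, ‖θ g‖₊ ≤ M) →
      ∀ (t : ↥(torusU σ J)) (d : Fin 3 → Kˣ), glDiagonal 3 K d = ((t : ↥(unitaryGroupOfForm σ J)) : GL (Fin 3) K) →
        ∀ (lam : ℕ), (∀ i k : Fin 3, i ≠ k → Valued.v (ϖ ^ lam) ≤ Valued.v ((d i : K) - d k)) →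
        ∀ (g y : ↥(unitaryGroupOfForm σ J)) (m : ℕ), g ∈ Ω m → g = y * (t : ↥(unitaryGroupOfForm σ J)) * y⁻¹ → ∀ (R : ℕ),
          ∫ x in Ω R, ‖θ (x * g * x⁻¹)‖ ∂μ ≤
            C * M * ((2 * (R + 2 * m + 2 * mθ + 4 * lam) + 1 : ℕ) : ℝ) * ((residueFieldCard K : ℝ≥0) : ℝ) ^ m *
              ((NNReal.sqrt (normAbs K ((d 0 : K) - d 1) * normAbs K ((d 0 : K) - d 2) * normAbs K ((d 1 : K) - d 2)))⁻¹ : ℝ) := by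
  obtain ⟨C, hC⟩ := exists_const_integral_heightBall_norm_conj_le σ hσ hσc hσv h2 hJ hϖ μ ρ μQ Ω hmem hinv hmul hunimod hK₁ hKB hμQ hρ mθ (E := E)
  refine ⟨C, fun θ hθc hθ M hM t d hd lam hreg g y m hg hgy R => ?_⟩
  have ha : IsUnit ((((d 0)⁻¹ * d 1 : Kˣ) : K) - 1) := isUnit_ratio_sub_one_of_depth hϖ hreg (by decide)
  have hb : IsUnit ((((d 0)⁻¹ * d 2 : Kˣ) : K) - 1) := isUnit_ratio_sub_one_of_depth hϖ hreg (by decide)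
  refine (hC θ hθc hθ M hM t d hd ha hb lam hreg g y m hg hgy R).trans ?_
  -- `t ∈ Ω m` (★ §2 of (D2)), hence `|ϖ^m d₀| ≤ 1`
  have htΩ : (t : ↥(unitaryGroupOfForm σ J)) ∈ (⇑Ω) m :=
    mem_heightBall_torus_of_conj_mem σ hσv hJ hϖ (⇑Ω) hmem hd (x := y) (by rw [← hgy]; exact hg)
  have hm : Valued.v (ϖ ^ m * (d 0 : K)) ≤ 1 := ((diag_mem_heightBall_iff σ hσv hJ hϖ (⇑Ω) hmem hd m).1 htΩ).1
  have hJle := twistModule_le_pow_mul_inv_sqrt_prod σ hσ hσc hσv hσ1 h2 hJ hϖ t hd ha hb hm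
  rw [mul_assoc (C * M * _ : ℝ)]
  refine mul_le_mul_of_nonneg_left ?_ (by positivity)
  exact_mod_cast hJle

end Assembly

/-! ## §4 The same bound in the line's frozen token `T(g) = √√(|discr χ_g| · |det g|⁻²)` -/

section Token

variable {K : Type*} [Field K] [Valued K ℤᵐ⁰] [ValuativeRel K] [(Valued.v : Valuation K ℤᵐ⁰).Compatible] [IsNonarchimedeanLocalField K]
  (σ : K →+* K) (hσv : ∀ x, Valued.v (σ x) = Valued.v x) {J : Matrix (Fin 3) (Fin 3) K} (hJ : J = (StdForm.antidiagonal 3).over K)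

include hσv hJ in
/-- **THE TOKEN AT A TORUS ELEMENT**: for `t = diag d ∈ T ≤ U(σ, Φ₃)(K)` one has `|det t| = |d₀d₁d₂| = 1` (★ `normAbs_det_torus_eq_one`) and `discr χ_t = ((d₁−d₀)(d₂−d₀)(d₂−d₁))²`
(★ `charpoly_discr_coe_glDiagonal`), so the line's frozen token `T(t) = √√(|discr χ_t| · |det t|⁻²)` equals `√(|d₀−d₁| |d₀−d₂| |d₁−d₂|)` = Harish-Chandra's `|D(t)|^{1∕2}`.
[cite: HarishChandra1970, Part VII §2 p. 69] [cite: Rogawski1990, §3.1 p. 19; §4.9 (4.9.2) p. 55] -/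
theorem sqrt_sqrt_token_eq_sqrt_prod (t : ↥(torusU σ J)) {d : Fin 3 → Kˣ} (hd : glDiagonal 3 K d = ((t : ↥(unitaryGroupOfForm σ J)) : GL (Fin 3) K)) :
    NNReal.sqrt (NNReal.sqrt
      (normAbs K (((glDiagonal 3 K d : GL (Fin 3) K) : Matrix (Fin 3) (Fin 3) K)).charpoly.discr *
        (normAbs K (((glDiagonal 3 K d : GL (Fin 3) K) : Matrix (Fin 3) (Fin 3) K)).det ^ 2)⁻¹)) =
      NNReal.sqrt (normAbs K ((d 0 : K) - d 1) * normAbs K ((d 0 : K) - d 2) * normAbs K ((d 1 : K) - d 2)) := by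
  have hrel := torus_rel σ hJ hd
  have hX : normAbs K ((((d 1 : K) - d 0) * ((d 2 : K) - d 0) * ((d 2 : K) - d 1)) ^ 2) =
      (normAbs K ((d 0 : K) - d 1) * normAbs K ((d 0 : K) - d 2) * normAbs K ((d 1 : K) - d 2)) ^ 2 := by
    rw [map_pow, map_mul (normAbs K), map_mul (normAbs K), ← neg_sub (d 0 : K) (d 1), ← neg_sub (d 0 : K) (d 2), ← neg_sub (d 1 : K) (d 2),
      normAbs_neg, normAbs_neg, normAbs_neg]
  rw [charpoly_discr_coe_glDiagonal, det_coe_glDiagonal, normAbs_det_torus_eq_one σ hσv hrel, one_pow, inv_one, mul_one, hX, NNReal.sqrt_sq]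

variable [T2Space K] [SecondCountableTopology K] [MeasurableSpace K] [BorelSpace K]
  (hσ : ∀ x, σ (σ x) = x) (hσc : Continuous σ) (hσ1 : ∃ x : K, σ x ≠ x) (h2 : (2 : K) ≠ 0)
  {ϖ : K} (hϖ : Valued.v ϖ = WithZero.exp (-1 : ℤ))
  [MeasurableSpace ↥(unitaryGroupOfForm σ J)] [BorelSpace ↥(unitaryGroupOfForm σ J)]
  [SecondCountableTopology ↥(unitaryGroupOfForm σ J)] [LocallyCompactSpace ↥(unitaryGroupOfForm σ J)]
  (μ : Measure ↥(unitaryGroupOfForm σ J)) [μ.IsHaarMeasure] [μ.IsMulRightInvariant]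
  (ρ : Measure ↥(torusU σ J)) [ρ.IsMulLeftInvariant] [SFinite ρ] [IsFiniteMeasureOnCompacts ρ]
  [MeasurableSpace (↥(unitaryGroupOfForm σ J) ⧸ torusU σ J)] [BorelSpace (↥(unitaryGroupOfForm σ J) ⧸ torusU σ J)]
  (μQ : Measure (↥(unitaryGroupOfForm σ J) ⧸ torusU σ J))
  [SMulInvariantMeasure ↥(unitaryGroupOfForm σ J) (↥(unitaryGroupOfForm σ J) ⧸ torusU σ J) μQ] [IsFiniteMeasureOnCompacts μQ]
  (Ω : CompactExhaustion ↥(unitaryGroupOfForm σ J))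
  (hmem : ∀ (m : ℕ) (g : ↥(unitaryGroupOfForm σ J)), g ∈ Ω m ↔
    (∀ i j, Valued.v (ϖ ^ m * ((g : GL (Fin 3) K) : Matrix (Fin 3) (Fin 3) K) i j) ≤ 1) ∧
      ∀ i j, Valued.v (ϖ ^ m * (((g : GL (Fin 3) K)⁻¹ : GL (Fin 3) K) : Matrix (Fin 3) (Fin 3) K) i j) ≤ 1)
  (hinv : ∀ (m : ℕ) (g : ↥(unitaryGroupOfForm σ J)), g ∈ Ω m → g⁻¹ ∈ Ω m)
  (hmul : ∀ (a b : ℕ) (g h : ↥(unitaryGroupOfForm σ J)), g ∈ Ω a → h ∈ Ω b → g * h ∈ Ω (a + b))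

include hσ hσc h2 hσv hσ1 hJ hϖ hmem hinv hmul in
/-- **(M5e-1″) THE SPLIT-REGULAR BALL BOUND IN THE FROZEN TOKEN `T(g)`** — the `hball` weight of ★ p856355 ∕ ★ [M6] on the split-regular locus of the model:
ONE `C` per `m_θ` with, for every continuous `θ` supported in `Ω_{m_θ}`, `‖θ‖ ≤ M`, every split-regular `g = y t y⁻¹ ∈ Ω_m` (`t = diag d` of depth `λ`) and every `R`,
`∫_{Ω R} ‖θ(x g x⁻¹)‖ dμ ≤ C · M · (2 (R + 2m + 2m_θ + 4λ) + 1) · q^m · T(g)⁻¹`, `T(g) = √√(|discr χ_g|_K · |det g|_K⁻²)` computed from `g` ITSELF (`χ` and `det` are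
conjugation invariant, §4 `sqrt_sqrt_token_eq_sqrt_prod`).  With ★ (M5e-2) `v_pow_le_v_sub_of_pow_normAbs_le_token` (`‖ϖ‖^τ ≤ T ⇒ λ ≤ 4τ + 10m`) every quantity on the
right is a function of `(m, m_θ, R, T(g))` alone — the shell-wise weight the assembler packages into `W`.
[cite: HarishChandra1970, Part VII §3 pp. 71–72, Theorem 19 p. 70; Part VI §8 Theorem 14 p. 60] [cite: Rogawski1990, §7.3 p. 97] -/
theorem exists_const_integral_heightBall_norm_conj_le_token
    (hunimod : ∀ ν : Measure ↥(unitaryGroupOfForm σ J), ν.IsHaarMeasure → ν.IsMulRightInvariant)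
    {K₁ : Subgroup ↥(unitaryGroupOfForm σ J)} (hK₁ : IsCompact (K₁ : Set ↥(unitaryGroupOfForm σ J)))
    (hKB : ∀ g : ↥(unitaryGroupOfForm σ J), ∃ k ∈ K₁, ∃ b ∈ borelU σ J, g = k * b)
    (hμQ : μQ ≠ 0) (hρ : ρ ≠ 0) (mθ : ℕ) {E : Type*} [NormedAddCommGroup E] :
    ∃ C : ℝ≥0, ∀ (θ : ↥(unitaryGroupOfForm σ J) → E), Continuous θ → (∀ g, θ g ≠ 0 → g ∈ Ω mθ) → ∀ (M : ℝ≥0), (∀ g, ‖θ g‖₊ ≤ M) →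
      ∀ (t : ↥(torusU σ J)) (d : Fin 3 → Kˣ), glDiagonal 3 K d = ((t : ↥(unitaryGroupOfForm σ J)) : GL (Fin 3) K) →
        ∀ (lam : ℕ), (∀ i k : Fin 3, i ≠ k → Valued.v (ϖ ^ lam) ≤ Valued.v ((d i : K) - d k)) →
        ∀ (g y : ↥(unitaryGroupOfForm σ J)) (m : ℕ), g ∈ Ω m → g = y * (t : ↥(unitaryGroupOfForm σ J)) * y⁻¹ → ∀ (R : ℕ),
          ∫ x in Ω R, ‖θ (x * g * x⁻¹)‖ ∂μ ≤
            C * M * ((2 * (R + 2 * m + 2 * mθ + 4 * lam) + 1 : ℕ) : ℝ) * ((residueFieldCard K : ℝ≥0) : ℝ) ^ m *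
              ((NNReal.sqrt (NNReal.sqrt
                (normAbs K (((g : GL (Fin 3) K) : Matrix (Fin 3) (Fin 3) K)).charpoly.discr *
                  (normAbs K (((g : GL (Fin 3) K) : Matrix (Fin 3) (Fin 3) K)).det ^ 2)⁻¹)))⁻¹ : ℝ) := by
  obtain ⟨C, hC⟩ := exists_const_integral_heightBall_norm_conj_le_sqrt_prod σ hσ hσc hσv hσ1 h2 hJ hϖ μ ρ μQ Ω hmem hinv hmul hunimod hK₁ hKB hμQ hρ mθ
    (E := E)
  refine ⟨C, fun θ hθc hθ M hM t d hd lam hreg g y m hg hgy R => ?_⟩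
  -- `χ_g = χ_t`, `det g = det t` (conjugation invariance), then §4's token identity
  have hcoe : (g : GL (Fin 3) K) = (y : GL (Fin 3) K) * (glDiagonal 3 K d : GL (Fin 3) K) * (y : GL (Fin 3) K)⁻¹ := by
    rw [hgy, hd]; rfl
  have hchar : (((g : GL (Fin 3) K) : Matrix (Fin 3) (Fin 3) K)).charpoly = (((glDiagonal 3 K d : GL (Fin 3) K) : Matrix (Fin 3) (Fin 3) K)).charpoly := by
    rw [hcoe, Units.val_mul, Units.val_mul, Matrix.coe_units_inv]
    exact Matrix.charpoly_units_conj (y : GL (Fin 3) K) _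
  have hdet : (((g : GL (Fin 3) K) : Matrix (Fin 3) (Fin 3) K)).det = (((glDiagonal 3 K d : GL (Fin 3) K) : Matrix (Fin 3) (Fin 3) K)).det := by
    rw [hcoe, Units.val_mul, Units.val_mul]
    exact Matrix.det_units_conj (y : GL (Fin 3) K) _
  rw [hchar, hdet, sqrt_sqrt_token_eq_sqrt_prod σ hσv hJ t hd]
  exact hC θ hθc hθ M hM t d hd lam hreg g y m hg hgy R

omit [ValuativeRel K] [(Valued.v : Valuation K ℤᵐ⁰).Compatible] [IsNonarchimedeanLocalField K] [T2Space K] [SecondCountableTopology K] [MeasurableSpace K]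
  [BorelSpace K] [MeasurableSpace ↥(unitaryGroupOfForm σ J)] [BorelSpace ↥(unitaryGroupOfForm σ J)] [SecondCountableTopology ↥(unitaryGroupOfForm σ J)]
  [LocallyCompactSpace ↥(unitaryGroupOfForm σ J)] [MeasurableSpace (↥(unitaryGroupOfForm σ J) ⧸ torusU σ J)] [BorelSpace (↥(unitaryGroupOfForm σ J) ⧸ torusU σ J)] in
include hσv hJ hϖ hmem in
/-- **ON `Ω_m` THE TORUS ENTRIES ARE CONTROLLED**: if `t = diag d` is conjugate into `Ω_m` (`y t y⁻¹ ∈ Ω_m`) then `|ϖ^m d_i| ≤ 1` and `|ϖ^m d_i⁻¹| ≤ 1` for every `i`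
(★ `mem_heightBall_torus_of_conj_mem` then the diagonal entries of `t^{±1}` through `hmem`). [cite: HarishChandra1970, Part VII §2 p. 69] -/
theorem v_pow_mul_torus_le_one_of_conj_mem {t y : ↥(unitaryGroupOfForm σ J)} {d : Fin 3 → Kˣ} (hd : glDiagonal 3 K d = (t : GL (Fin 3) K))
    {m : ℕ} (hg : y * t * y⁻¹ ∈ Ω m) (i : Fin 3) :
    Valued.v (ϖ ^ m * (d i : K)) ≤ 1 ∧ Valued.v (ϖ ^ m * ((d i : K))⁻¹) ≤ 1 := by
  have htΩ : t ∈ (⇑Ω) m := mem_heightBall_torus_of_conj_mem σ hσv hJ hϖ (⇑Ω) hmem hd hg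
  obtain ⟨hA, hB⟩ := (hmem m t).1 htΩ
  refine ⟨?_, ?_⟩
  · have := hA i i
    rwa [← hd, coe_glDiagonal, Matrix.diagonal_apply_eq] at this
  · have := hB i i
    rwa [← hd, coe_inv_glDiagonal, Matrix.diagonal_apply_eq] at this

include hσ hσc h2 hσv hσ1 hJ hϖ hmem hinv hmul in
/-- **(M5e-1‴) THE SHELL FORM — NO DEPTH BINDER LEFT.**  On the shell `T(g) ≥ ‖ϖ‖^τ` of the height ball `Ω_m`, ★ (M5e-2) `v_pow_le_v_sub_of_pow_normAbs_le_token` says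
`t` has depth `λ := 4τ + 10m`, so (M5e-1″) reads, for every continuous `θ` supported in `Ω_{m_θ}` with `‖θ‖ ≤ M`, every split `g = y t y⁻¹ ∈ Ω_m` with `‖ϖ‖^τ ≤ T(g)`, every `R`:
`∫_{Ω R} ‖θ(x g x⁻¹)‖ dμ ≤ C · M · (2 (R + 42m + 2m_θ + 16τ) + 1) · q^m · T(g)⁻¹` — the right-hand side is a function of `(m, m_θ, R, τ, T(g))` alone, i.e. on shells
`‖ϖ‖^{τ} ≤ T < ‖ϖ‖^{τ−1}` it is `≍ T⁻¹ (1 + |log_q T|)`: the weight `W` of ★ p856355's `hball` the assembler packages (locally integrable by the HC-D-ε road: `T^{-(1+δ)} ∈ L¹_loc`).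
[cite: HarishChandra1970, Part VII §3 pp. 71–72, Theorem 19 p. 70; Part VI §8 Theorem 14 p. 60] [cite: Rogawski1990, §7.3 p. 97] -/
theorem exists_const_integral_heightBall_norm_conj_le_shell
    (hunimod : ∀ ν : Measure ↥(unitaryGroupOfForm σ J), ν.IsHaarMeasure → ν.IsMulRightInvariant)
    {K₁ : Subgroup ↥(unitaryGroupOfForm σ J)} (hK₁ : IsCompact (K₁ : Set ↥(unitaryGroupOfForm σ J)))
    (hKB : ∀ g : ↥(unitaryGroupOfForm σ J), ∃ k ∈ K₁, ∃ b ∈ borelU σ J, g = k * b)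
    (hμQ : μQ ≠ 0) (hρ : ρ ≠ 0) (mθ : ℕ) {E : Type*} [NormedAddCommGroup E] :
    ∃ C : ℝ≥0, ∀ (θ : ↥(unitaryGroupOfForm σ J) → E), Continuous θ → (∀ g, θ g ≠ 0 → g ∈ Ω mθ) → ∀ (M : ℝ≥0), (∀ g, ‖θ g‖₊ ≤ M) →
      ∀ (t : ↥(torusU σ J)) (d : Fin 3 → Kˣ), glDiagonal 3 K d = ((t : ↥(unitaryGroupOfForm σ J)) : GL (Fin 3) K) →
        ∀ (g y : ↥(unitaryGroupOfForm σ J)) (m : ℕ), g ∈ Ω m → g = y * (t : ↥(unitaryGroupOfForm σ J)) * y⁻¹ →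
        ∀ (τ : ℕ), normAbs K ϖ ^ τ ≤ NNReal.sqrt (NNReal.sqrt
            (normAbs K (((g : GL (Fin 3) K) : Matrix (Fin 3) (Fin 3) K)).charpoly.discr *
              (normAbs K (((g : GL (Fin 3) K) : Matrix (Fin 3) (Fin 3) K)).det ^ 2)⁻¹)) → ∀ (R : ℕ),
          ∫ x in Ω R, ‖θ (x * g * x⁻¹)‖ ∂μ ≤
            C * M * ((2 * (R + 42 * m + 2 * mθ + 16 * τ) + 1 : ℕ) : ℝ) * ((residueFieldCard K : ℝ≥0) : ℝ) ^ m *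
              ((NNReal.sqrt (NNReal.sqrt
                (normAbs K (((g : GL (Fin 3) K) : Matrix (Fin 3) (Fin 3) K)).charpoly.discr *
                  (normAbs K (((g : GL (Fin 3) K) : Matrix (Fin 3) (Fin 3) K)).det ^ 2)⁻¹)))⁻¹ : ℝ) := by
  obtain ⟨C, hC⟩ := exists_const_integral_heightBall_norm_conj_le_token σ hσv hJ hσ hσc hσ1 h2 hϖ μ ρ μQ Ω hmem hinv hmul hunimod hK₁ hKB hμQ hρ mθ
    (E := E)
  refine ⟨C, fun θ hθc hθ M hM t d hd g y m hg hgy τ hτ R => ?_⟩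
  -- the token of `g` is the token of `diag d` (conjugation invariance, as in (M5e-1″))
  have hcoe : (g : GL (Fin 3) K) = (y : GL (Fin 3) K) * (glDiagonal 3 K d : GL (Fin 3) K) * (y : GL (Fin 3) K)⁻¹ := by
    rw [hgy, hd]; rfl
  have hchar : (((g : GL (Fin 3) K) : Matrix (Fin 3) (Fin 3) K)).charpoly = (((glDiagonal 3 K d : GL (Fin 3) K) : Matrix (Fin 3) (Fin 3) K)).charpoly := by
    rw [hcoe, Units.val_mul, Units.val_mul, Matrix.coe_units_inv]
    exact Matrix.charpoly_units_conj (y : GL (Fin 3) K) _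
  have hdet : (((g : GL (Fin 3) K) : Matrix (Fin 3) (Fin 3) K)).det = (((glDiagonal 3 K d : GL (Fin 3) K) : Matrix (Fin 3) (Fin 3) K)).det := by
    rw [hcoe, Units.val_mul, Units.val_mul]
    exact Matrix.det_units_conj (y : GL (Fin 3) K) _
  rw [hchar, hdet] at hτ
  -- the torus entries on `Ω m`, then ★ (M5e-2): depth `4τ + 10m`
  have hgt : y * (t : ↥(unitaryGroupOfForm σ J)) * y⁻¹ ∈ Ω m := by rw [← hgy]; exact hg
  have hdm := fun i => (v_pow_mul_torus_le_one_of_conj_mem σ hσv hJ hϖ Ω hmem hd hgt i).1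
  have hdm' := fun i => (v_pow_mul_torus_le_one_of_conj_mem σ hσv hJ hϖ Ω hmem hd hgt i).2
  have hreg : ∀ i k : Fin 3, i ≠ k → Valued.v (ϖ ^ (4 * τ + 10 * m)) ≤ Valued.v ((d i : K) - d k) := fun i k hik =>
    v_pow_le_v_sub_of_pow_normAbs_le_token hϖ hdm hdm' hτ hik
  have e : 2 * (R + 2 * m + 2 * mθ + 4 * (4 * τ + 10 * m)) + 1 = 2 * (R + 42 * m + 2 * mθ + 16 * τ) + 1 := by ring
  rw [← e]
  exact hC θ hθc hθ M hM t d hd (4 * τ + 10 * m) hreg g y m hg hgy R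

end Token

end Summit.HodgeConjecture.HodgeConjecture.Cruxes.H413.K2E3SupercuspBallBoundSplitAssembly

end
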